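import Literature.NumberTheory.EllipticCurves.Rank1Residual.X9MuInvariant
import Literature.NumberTheory.EllipticCurves.Rank1Residual.Typed.X10bHeegnerIndexCertificate
import Literature.NumberTheory.EllipticCurves.Rank1Residual.Typed.X9
import HarnessLib

/-!
# Class X9, analytic rank 0: the LOWER bound `ord_p #Ш ≥ ord_p #Ш_an` holds from PUBLISHED theorems
# plus one finite certificate `μ(𝓛_p(E)) = 0` — so the SHA rows close with Cha's index bound alone
# (cell `b2b-bsdres`, unit `b2b-bsdres-x9`, gen 9)

HONEST FRAMING (run/shared/lean/b2b/bsd-rank1-residual/, verbatim in every file): the goal of the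
cell is to DELETE the COMBINATION-SHAPED residual classes of the Birch–Swinnerton-Dyer formula for
ALL analytic-rank `≤ 1` elliptic curves over `ℚ` — "full BSD formula for every rank `≤ 1` curve in
class `C`" assembled STRICTLY from published theorems — so that the rank-`≤ 1` remainder becomes
exactly the CONSTRUCTION-SHAPED classes, which are TYPED (missing-input `Prop`s), NOT attempted.
This is not "finishing BSD". Theorems only; NO named fact is introduced; X9's label (typed) is not
changed; no pair is booked by this file (the lane books, the referee rules).

## The observation (our own work, hence `Summits/`)

The X9 prover gen 5 (`Rank1Residual/X9MuInvariant.lean`) ran the rank-0 Euler-characteristic chain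
of Castella–Grossi–Lee–Skinner's proof of Thm. 5.1.4 with an EXPONENT: Burungale–Castella–Skinner
2025 Thm. 1.1.2 (a) (PUB; `p ≥ 5` good ordinary, `E[p]` irreducible — NO image hypothesis) gives
`char_Λ X(E/ℚ_∞) = (g)`, `ι g = p^k · L_p(f, α)` for some `k ∈ ℤ`, and then
(`padicValRat_lvalue_add_exponent_of_charIdeal_eq`, Greenberg LNM 1716 Thm. 4.1 + GZK + modularity)

  `ord_p (L(E,1)/Ω_E) + k = ord_p #Ш(E) + ord_p ∏ c_ℓ − 2·ord_p #E(ℚ)_tors`.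

Gen 5 read this as `BSD(E,p) ⟺ k = 0 ⟺ μ(X) = 0` (given `μ(L_p) = 0`). This file records the
ONE-SIDED half that needs NO conjecture: `g ∈ Λ = ℤ_p⟦T⟧` has `p`-integral coefficients, so if
SOME coefficient of `L_p(f, α)` is a `p`-adic unit (the finite certificate "`μ(𝓛_p(E)) = 0`", exact
modular symbols; the cell's Iwasawa-census engines compute it with the Stein–Wuthrich precision
rule) then `k ≥ 0` (`exponent_nonneg_of_exists_norm_coeff_eq_one`), whence

  **`ord_p #Ш(E)_an ≤ ord_p #Ш(E)`** (`missingLowerBoundAt_of_unitCoeff_of_analyticRank_eq_zero`,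
  the typed LOWER half `Typed.MissingLowerBoundAt W p` of `Rank1Residual/Typed/Basic.lean`).

So on class X9 in analytic rank 0 the "IMC half" of the `p`-part of BSD is in print plus a finite
certificate, and the typed residue is ONLY the "Euler-system half" `ord_p #Ш ≤ ord_p #Ш_an`
(`missingInputAt_of_missingUpperBoundAt_of_unitCoeff`). That half is what the Heegner-index
certificates deliver per pair (Cha 2005 = Miller 2011 Thm. 5.2, named fact
`Cha2005.thm52_padicValNat_shaOrder_le`, valid for IRREDUCIBLE `ρ̄` — no surjectivity): with an index
certificate `ord_p [E(K) : ℤ y_K] ≤ k` and `2k ≤ ord_p #Ш_an` the two halves meet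
(`bsdp_of_cha_of_unitCoeff_of_analyticRank_eq_zero`: `BSDp W p`, and `ord_p #Ш(E) = 2k` exactly).

Census consequence (HOME/b2b-bsdres-x9/X9-CENSUS-G8.md §3–4): the 13 rank-0 X9 "SHA rows"
(`ord_5 #Ш_an = 2`, `N < 5·10⁵`) had their UPPER half per pair (index certificates `ord_5 = 1` on two
engines for 11 of them) and were missing the LOWER certificate `Ш(E)[5] ≠ 0`, which gen 8 supplied
by VISIBILITY for the 4 pairs having a rank-2 congruent partner in Cremona's table.  With this file
the lower half needs NO partner: the certificate is `μ(𝓛_5(E)) = 0` (one unit coefficient), for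
every SHA row alike.

## Contents

* `exponent_nonneg_of_exists_norm_coeff_eq_one` — `ι g = p^k · L`, `g ∈ Λ`, a unit coefficient of
  `L` ⟹ `0 ≤ k` (the first half of gen 5's `exponent_eq_zero_of_hasUnitContent`, isolated);
* `missingLowerBoundAt_of_unitCoeff_of_analyticRank_eq_zero` — class-free: `p ≥ 5` good ordinary,
  `E[p]` irreducible, `r_an = 0`, certificate ⟹ `Typed.MissingLowerBoundAt W p`; published binders
  BCS 2025 Thm. 1.1.2 (a) (`hBCS`), Greenberg LNM 1716 Thm. 4.1 (`hGr`), the period unit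
  `Ω_E = u·Ω⁺_f` (`h5`, Greenberg–Vatsal §3), modularity (`hmodP`, `hmodL`), GZK (`hGZK`);
* `bsdp_of_cha_of_unitCoeff_of_analyticRank_eq_zero`, `padicValNat_shaOrder_eq_of_cha_of_unitCoeff…`
  — + Cha 2005 (`hCha`) with a Heegner field / point and the index certificate ⟹ `BSDp W p`,
  `ord_p #Ш = 2k = ord_p #Ш_an`;
* `bsdp_of_classX9_of_cha_of_unitCoeff`, `missingInputAt_of_classX9_of_cha_of_unitCoeff`,
  `mu_eq_zero_of_classX9_of_cha_of_unitCoeff` — the same over `ClassX9` (non-CM, `p ≥ 5`, irr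
  automatic), the typed input `Typed.X9.MissingInputAt` DISCHARGED at such a pair, and — through
  gen 5's converse `X9.mu_eq_zero_of_bsdp` — Greenberg's `μ(X(E/ℚ_∞)) = 0` PROVED for the pair;
* `missingInputAt_of_missingUpperBoundAt_of_unitCoeff` — on X9 ∧ `r = 0` the typed residue reduces
  to the upper half.

## References

* [BurungaleCastellaSkinner2025] IMRN 2025 = arXiv:2405.00270v2, Thm. 1.1.2 (a) (p. 2).
* [GreenbergLNM1716] R. Greenberg, LNM 1716 (1999), Thm. 4.1 (p. 102); §1 Conj. 1.11.
* [GreenbergVatsal2000] Invent. Math. 142, Prop. 3.7 (integrality of `L_p`), §3 (3.4).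
* [CastellaEtAl2021] Castella–Grossi–Lee–Skinner, Invent. Math. 227 (2022), proof of Thm. 5.1.4.
* [Miller2011LMS] R. L. Miller, LMS J. Comput. Math. 14 (2011), Thm. 5.2 (Cha's bound), Def. 1.1.
* [SteinWuthrich2013] W. Stein, C. Wuthrich, Math. Comp. 82 (2013), §3 (computing `μ`, `λ`).
-/

set_option autoImplicit false

noncomputable section

open scoped Classical MatrixGroups ModularForm

open CongruenceSubgroup WeierstrassCurve Literature.NumberTheory.EllipticCurves
  Literature.NumberTheory.EllipticCurves.ModularForms Literature.NumberTheory.EllipticCurves.Rank1Residual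

namespace Summit.BirchSwinnertonDyer.Rank1Residual.X9

/-- **A unit coefficient of `L` forces a non-negative exponent.**  For `g ∈ Λ = ℤ_p⟦T⟧`,
`L ∈ ℚ_p⟦T⟧` and `ι g = p^k · L` (`ι : Λ → ℚ_p⟦T⟧`): if some coefficient of `L` has norm `1`, then
`0 ≤ k` — the `n`-th coefficient gives `p^{-k} = ‖g_n‖ ≤ 1`.  (First half of gen 5's
`exponent_eq_zero_of_hasUnitContent`, which adds `k ≤ 0` from `μ(g) = 0`; here no hypothesis on
`g`.) [folklore] -/
theorem exponent_nonneg_of_exists_norm_coeff_eq_one {p : ℕ} [Fact p.Prime] (g : IwasawaAlgebra p)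
    (L : PowerSeries ℚ_[p]) (k : ℤ)
    (h : iwasawaToPowerSeries p g = PowerSeries.C ((p : ℚ_[p]) ^ k) * L)
    (hunit : ∃ n : ℕ, ‖PowerSeries.coeff n L‖ = 1) : 0 ≤ k := by
  have hpP : p.Prime := Fact.out
  have hp1 : (1 : ℝ) < p := by exact_mod_cast hpP.one_lt
  obtain ⟨n, hn⟩ := hunit
  have hcoeff : ‖((PowerSeries.coeff n g : ℤ_[p]) : ℚ_[p])‖ = (p : ℝ) ^ (-k) * ‖PowerSeries.coeff n L‖ := by
    have hn' := congrArg (PowerSeries.coeff n) h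
    rw [iwasawaToPowerSeries, PowerSeries.coeff_map, PowerSeries.coeff_C_mul] at hn'
    change ((PowerSeries.coeff n g : ℤ_[p]) : ℚ_[p]) = _ at hn'
    rw [hn', norm_mul, norm_zpow, Padic.norm_p, inv_zpow', zpow_neg]
  have hle : (p : ℝ) ^ (-k) ≤ 1 := by
    have h1 : ‖((PowerSeries.coeff n g : ℤ_[p]) : ℚ_[p])‖ ≤ 1 := by
      rw [PadicInt.padic_norm_e_of_padicInt]; exact PadicInt.norm_le_one _
    rw [hcoeff, hn, mul_one] at h1
    exact h1
  by_contra hlt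
  rw [not_le] at hlt
  have : (1 : ℝ) < (p : ℝ) ^ (-k) := one_lt_zpow₀ hp1 (by omega)
  linarith

variable (W : WeierstrassCurve ℚ) [W.IsElliptic] [W.IsGloballyMinimal] (p : ℕ) [Fact p.Prime]

/-- **Analytic rank 0, `p ≥ 5` good ordinary, `E[p]` irreducible: `ord_p #Ш(E)_an ≤ ord_p #Ш(E)`
from PUBLISHED theorems plus the certificate `μ(𝓛_p(E)) = 0`.**  Binders: BCS 2025 Thm. 1.1.2 (a)
(`hBCS`: `char X = (g)`, `ι g = p^k L_p(f,α)`, NO image hypothesis), Greenberg's Thm. 4.1 (`hGr`),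
the period unit (`h5`), modularity (`hmodP`, `hmodL`), Gross–Zagier–Kolyvagin (`hGZK`); the finite
certificate `hcert`: for the newform `f` of `E` and `ϖ·Ω_E = Ω⁺_f`, SOME coefficient of
`𝓛_MSD(E) = ϖ·L_p(f, α)` is a `p`-adic unit.  Proof: `k ≥ 0`
(`exponent_nonneg_of_exists_norm_coeff_eq_one`), and the exponent chain
`padicValRat_lvalue_add_exponent_of_charIdeal_eq` gives `ord_p(L(E,1)/Ω_E) + k = ord_p #Ш +
ord_p ∏c_ℓ − 2 ord_p #E(ℚ)_tors`; with `#Ш_an = (L(E,1)/Ω_E)·#E(ℚ)_tors²/∏c_ℓ` (rank 0, `Reg = 1`)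
this is `ord_p #Ш_an = ord_p #Ш − k ≤ ord_p #Ш`.  No `μ`-conjecture is used.
[cite: BurungaleCastellaSkinner2025, Thm. 1.1.2 (a) (p. 2 of arXiv:2405.00270v2)]
[cite: GreenbergLNM1716, Thm. 4.1 (p. 102)] [cite: CastellaEtAl2021, Thm. 5.1.4 and its proof (§5.1.3)] -/
theorem missingLowerBoundAt_of_unitCoeff_of_analyticRank_eq_zero
    (hBCS : burungale_castella_skinner_charIdeal_eq_padicLFunction)
    (hGr : greenberg_charValue_rankZero) (h5 : realPeriodRat_eq_unit_mul_plusPeriod)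
    (hmodP : nonempty_modularParametrizationData) (hmodL : hasEntireLFunction_rat)
    (hGZK : rank_eq_analyticRank_of_analyticRank_le_one)
    (hp : 5 ≤ p) (hord : GoodOrd W p) (hirr : Irr W p) (hr : W.analyticRank = 0)
    (hcert : ∀ [NeZero (W.conductorNorm ℤ)] (f : CuspForm (Gamma0 (W.conductorNorm ℤ)) 2),
        IsNewformOf W f → ∀ (ϖ : ℚ), (ϖ : ℝ) * W.realPeriodRat = plusPeriod f →
      ∃ n : ℕ, ‖PowerSeries.coeff n
        (PowerSeries.C (ϖ : ℚ_[p]) * padicLFunction f (unitRoot W p : ℚ_[p]))‖ = 1) :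
    Typed.MissingLowerBoundAt W p := by
  obtain ⟨hgood, hordp⟩ := hord
  have hpP : p.Prime := Fact.out
  have hp2 : p ≠ 2 := by omega
  have hL : W.entireLFunction 1 ≠ 0 := (W.analyticRank_eq_zero_iff_holds (hmodL W)).1 hr
  have hfin : Finite W.sha := (hGZK W (by omega)).2
  haveI := hfin
  -- the newform and the period ratio
  haveI : NeZero (W.conductorNorm ℤ) := ⟨(W.conductorNorm_pos_holds).ne'⟩
  obtain ⟨Dm⟩ := hmodP W
  have hf : IsNewformOf W Dm.f := Dm.isNewformOf
  obtain ⟨ϖ, hϖpos, hϖeq, -⟩ := Dm.exists_rat_mul_realPeriodRat_eq_plusPeriod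
  have hϖnorm : ‖(ϖ : ℚ_[p])‖ = 1 := norm_periodRatio_eq_one h5 W p hp hgood hirr Dm.f hf ϖ hϖeq
  have hϖv : padicValRat p ϖ = 0 := by
    have h := Padic.norm_eq_zpow_neg_valuation (show ((ϖ : ℚ) : ℚ_[p]) ≠ 0 by exact_mod_cast hϖpos.ne')
    rw [hϖnorm, Padic.valuation_ratCast] at h
    have hp1 : (1 : ℝ) < p := by exact_mod_cast hpP.one_lt
    have h0 : (p : ℝ) ^ (0 : ℤ) = (p : ℝ) ^ (-padicValRat p ϖ) := by rw [zpow_zero]; exact h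
    have := zpow_right_injective₀ (zero_lt_one.trans hp1) hp1.ne' h0
    omega
  -- the cyclotomic setting and a dual datum
  obtain ⟨κ, hκ, γ, hγ, hγ'⟩ := exists_isCyclotomic_isTopGenerator_isCyclotomicVariable_holds p
  obtain ⟨D⟩ := W.nonempty_selmerDualData_holds κ γ hγ
  -- BCS (a): `char X = (g)`, `ι g = p^k · L_p(f, α)`
  obtain ⟨hX, g, k, hchar, hιg⟩ := hBCS W p κ γ Dm.f hp hgood hordp hirr hκ hγ hγ' hf D
  -- `k ≥ 0` from the certificate (a unit coefficient of `L_p(f, α)`)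
  have hcert' : ∃ n : ℕ, ‖PowerSeries.coeff n (padicLFunction Dm.f (unitRoot W p : ℚ_[p]))‖ = 1 := by
    obtain ⟨n, hn⟩ := hcert Dm.f hf ϖ hϖeq
    refine ⟨n, ?_⟩
    rwa [PowerSeries.coeff_C_mul, norm_mul, hϖnorm, one_mul] at hn
  have hk : 0 ≤ k := exponent_nonneg_of_exists_norm_coeff_eq_one g _ k hιg hcert'
  -- the chain with exponent `k`
  obtain ⟨t, htq, hval⟩ := padicValRat_lvalue_add_exponent_of_charIdeal_eq W p hgood hordp hL hfin
    (hGr W p hp2 hgood hordp) κ γ hκ hγ hγ' Dm.f hf ϖ hϖeq hϖv D hX g k hchar hιg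
  -- `#Ш_an = t · #E(ℚ)_tors² / ∏ c_ℓ` in rank 0
  have hΩC : (W.realPeriodRat : ℂ) ≠ 0 := Complex.ofReal_ne_zero.mpr W.realPeriodRat_pos_holds.ne'
  have hT : 0 < W.torsionOrder := W.torsionOrder_pos_holds
  have hc : 0 < W.tamagawaProduct := W.tamagawaProduct_pos'
  have hT0 : (W.torsionOrder : ℚ) ≠ 0 := by exact_mod_cast hT.ne'
  have hc0 : (W.tamagawaProduct : ℚ) ≠ 0 := by exact_mod_cast hc.ne'
  have hr0 : W.mordellWeilRank = 0 := (hGZK W (by omega)).1.trans hr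
  have hReg : W.regulator = 1 := W.regulator_eq_one_of_rank_zero hr0
  have hL1 : W.entireLFunction 1 = (t : ℂ) * (W.realPeriodRat : ℂ) := by
    rw [← htq, div_mul_cancel₀ _ hΩC]
  have ht0 : t ≠ 0 := by
    rintro rfl
    apply hL
    rw [hL1]
    simp
  set q : ℚ := t * (W.torsionOrder : ℚ) ^ 2 / (W.tamagawaProduct : ℚ) with hq_def
  have hsha : shaAn W = (q : ℂ) := by
    rw [shaAn_def, W.leadingLCoeff_eq_of_analyticRank_eq_zero hr, hL1, hReg, hq_def]
    have hcC : ((W.tamagawaProduct : ℚ) : ℂ) ≠ 0 := by exact_mod_cast hc.ne'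
    push_cast
    field_simp
  refine ⟨q, hsha, ?_⟩
  have hvq : padicValRat p q = padicValRat p t + 2 * padicValNat p W.torsionOrder -
      padicValNat p W.tamagawaProduct := by
    rw [hq_def, padicValRat.div (mul_ne_zero ht0 (pow_ne_zero 2 hT0)) hc0,
      padicValRat.mul ht0 (pow_ne_zero 2 hT0), padicValRat.pow, padicValRat.of_nat, padicValRat.of_nat]
    push_cast
    ring
  rw [hvq]
  simp only [WeierstrassCurve.shaOrder] at hval ⊢
  linarith


section Closure

variable {N : ℕ} [NeZero N] {K : Type} [Field K] [NumberField K]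

/-- **Rank 0: `BSD(E,p)` from Cha's index bound (UPPER) and the Iwasawa lower bound (LOWER).**
Class-free: `E` non-CM, `p ≥ 5` good ordinary, `E[p]` irreducible, `r_an = 0`; a Heegner field `K`
(imaginary quadratic, Heegner hypothesis for the level `N`, `p ∤ d_K`, `p² ∤ N`) with Heegner point
`P = y_K` of infinite order and index certificate `ord_p [E(K) : ℤ P] ≤ k`; `#Ш_an = q` with
`2k ≤ ord_p q`; and the certificate `μ(𝓛_p(E)) = 0` (`hcert`).  Then Cha 2005 (`hCha`, Miller
Thm. 5.2: `ord_p #Ш ≤ 2·ord_p index ≤ 2k ≤ ord_p q`) and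
`missingLowerBoundAt_of_unitCoeff_of_analyticRank_eq_zero` (`ord_p q ≤ ord_p #Ш`) meet:
`Typed.missingPPartAt_of_lower_of_upper`, `Typed.bsdp_of_missingPPartAt`.  NO visibility partner, no
descent, no surjectivity. [cite: Miller2011LMS, Thm. 5.2 and Def. 1.1]
[cite: BurungaleCastellaSkinner2025, Thm. 1.1.2 (a) (p. 2 of arXiv:2405.00270v2)] -/
theorem bsdp_of_cha_of_unitCoeff_of_analyticRank_eq_zero
    (hBCS : burungale_castella_skinner_charIdeal_eq_padicLFunction)
    (hGr : greenberg_charValue_rankZero) (h5 : realPeriodRat_eq_unit_mul_plusPeriod)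
    (hmodP : nonempty_modularParametrizationData) (hmodL : hasEntireLFunction_rat)
    (hGZK : rank_eq_analyticRank_of_analyticRank_le_one)
    (hCha : Cha2005.thm52_padicValNat_shaOrder_le)
    (hcm : ¬ W.HasCM) (hp : 5 ≤ p) (hord : GoodOrd W p) (hirr : Irr W p) (hr : W.analyticRank = 0)
    (hK : IsImaginaryQuadratic K) (hH : SatisfiesHeegnerHypothesis N K)
    {P : (W.baseChange K).toAffine.Point} (hP : IsHeegnerPoint N W K P) (hnt : ¬ IsOfFinAddOrder P)
    (hpD : ¬ (p : ℤ) ∣ NumberField.discr K) (hpN : ¬ p ^ 2 ∣ N)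
    {k : ℕ} (hI : padicValNat p (AddSubgroup.zmultiples P).index ≤ k)
    {q : ℚ} (hq : shaAn W = (q : ℂ)) (hv : (2 * k : ℤ) ≤ padicValRat p q)
    (hcert : ∀ [NeZero (W.conductorNorm ℤ)] (f : CuspForm (Gamma0 (W.conductorNorm ℤ)) 2),
        IsNewformOf W f → ∀ (ϖ : ℚ), (ϖ : ℝ) * W.realPeriodRat = plusPeriod f →
      ∃ n : ℕ, ‖PowerSeries.coeff n
        (PowerSeries.C (ϖ : ℚ_[p]) * padicLFunction f (unitRoot W p : ℚ_[p]))‖ = 1) :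
    BSDp W p := by
  have hp2 : p ≠ 2 := by omega
  have hr1 : W.analyticRank ≤ 1 := by omega
  exact Typed.bsdp_of_missingPPartAt W p hGZK hr1
    (Typed.missingPPartAt_of_lower_of_upper W p
      (missingLowerBoundAt_of_unitCoeff_of_analyticRank_eq_zero W p hBCS hGr h5 hmodP hmodL hGZK hp
        hord hirr hr hcert)
      (Typed.missingUpperBoundAt_of_cha_of_index_le W p hCha hcm hr1 hK hH hP hnt hp2 hpD hpN hirr
        hI hq hv))

/-- **Under the same data the `p`-part is EXACT: `ord_p #Ш(E) = 2k = ord_p #Ш(E)_an`.**  (For the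
census SHA rows: `k = 1`, `ord_5 #Ш(E) = 2`.) [cite: Miller2011LMS, Thm. 5.2] -/
theorem padicValNat_shaOrder_eq_of_cha_of_unitCoeff_of_analyticRank_eq_zero
    (hBCS : burungale_castella_skinner_charIdeal_eq_padicLFunction)
    (hGr : greenberg_charValue_rankZero) (h5 : realPeriodRat_eq_unit_mul_plusPeriod)
    (hmodP : nonempty_modularParametrizationData) (hmodL : hasEntireLFunction_rat)
    (hGZK : rank_eq_analyticRank_of_analyticRank_le_one)
    (hCha : Cha2005.thm52_padicValNat_shaOrder_le)
    (hcm : ¬ W.HasCM) (hp : 5 ≤ p) (hord : GoodOrd W p) (hirr : Irr W p) (hr : W.analyticRank = 0)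
    (hK : IsImaginaryQuadratic K) (hH : SatisfiesHeegnerHypothesis N K)
    {P : (W.baseChange K).toAffine.Point} (hP : IsHeegnerPoint N W K P) (hnt : ¬ IsOfFinAddOrder P)
    (hpD : ¬ (p : ℤ) ∣ NumberField.discr K) (hpN : ¬ p ^ 2 ∣ N)
    {k : ℕ} (hI : padicValNat p (AddSubgroup.zmultiples P).index ≤ k)
    {q : ℚ} (hq : shaAn W = (q : ℂ)) (hv : (2 * k : ℤ) ≤ padicValRat p q)
    (hcert : ∀ [NeZero (W.conductorNorm ℤ)] (f : CuspForm (Gamma0 (W.conductorNorm ℤ)) 2),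
        IsNewformOf W f → ∀ (ϖ : ℚ), (ϖ : ℝ) * W.realPeriodRat = plusPeriod f →
      ∃ n : ℕ, ‖PowerSeries.coeff n
        (PowerSeries.C (ϖ : ℚ_[p]) * padicLFunction f (unitRoot W p : ℚ_[p]))‖ = 1) :
    (padicValNat p W.shaOrder : ℤ) = 2 * k ∧ padicValRat p q = 2 * k := by
  have hp2 : p ≠ 2 := by omega
  have hr1 : W.analyticRank ≤ 1 := by omega
  obtain ⟨q₁, hq₁, hle₁⟩ := missingLowerBoundAt_of_unitCoeff_of_analyticRank_eq_zero W p hBCS hGr h5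
    hmodP hmodL hGZK hp hord hirr hr hcert
  have hqq : q₁ = q := by exact_mod_cast hq₁.symm.trans hq
  subst hqq
  have hup := hCha W N K hK hH P hP hnt p hcm hp2 hpD hpN hirr hr1
  have hI' : ((padicValNat p (AddSubgroup.zmultiples P).index : ℕ) : ℤ) ≤ k := by
    exact_mod_cast hI
  have hup' : (padicValNat p W.shaOrder : ℤ) ≤ 2 * k := by
    have h2 : (padicValNat p W.shaOrder : ℤ) ≤
        ((2 * padicValNat p (AddSubgroup.zmultiples P).index : ℕ) : ℤ) := by exact_mod_cast hup
    rw [Nat.cast_mul, Nat.cast_ofNat] at h2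
    linarith
  constructor <;> linarith

/-- **Class X9, rank 0: `BSD(E,p)` at a pair carrying the Heegner-index certificate and the
`μ(𝓛_p(E)) = 0` certificate** — `bsdp_of_cha_of_unitCoeff_of_analyticRank_eq_zero` over the cell's
`ClassX9` (non-CM, `p ≥ 5` good ordinary, `E[p]` irreducible are AUTOMATIC; `¬surj` unused).  The
typed target delivered POINTWISE at every rank-0 SHA row with both certificates; not a class
theorem. [cite: Miller2011LMS, Thm. 5.2 and Def. 1.1] -/
theorem bsdp_of_classX9_of_cha_of_unitCoeff
    (hBCS : burungale_castella_skinner_charIdeal_eq_padicLFunction)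
    (hGr : greenberg_charValue_rankZero) (h5 : realPeriodRat_eq_unit_mul_plusPeriod)
    (hmodP : nonempty_modularParametrizationData) (hmodL : hasEntireLFunction_rat)
    (hGZK : rank_eq_analyticRank_of_analyticRank_le_one)
    (hCha : Cha2005.thm52_padicValNat_shaOrder_le)
    (hX9 : ClassX9 W p) (hr : W.analyticRank = 0)
    (hK : IsImaginaryQuadratic K) (hH : SatisfiesHeegnerHypothesis N K)
    {P : (W.baseChange K).toAffine.Point} (hP : IsHeegnerPoint N W K P) (hnt : ¬ IsOfFinAddOrder P)
    (hpD : ¬ (p : ℤ) ∣ NumberField.discr K) (hpN : ¬ p ^ 2 ∣ N)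
    {k : ℕ} (hI : padicValNat p (AddSubgroup.zmultiples P).index ≤ k)
    {q : ℚ} (hq : shaAn W = (q : ℂ)) (hv : (2 * k : ℤ) ≤ padicValRat p q)
    (hcert : ∀ [NeZero (W.conductorNorm ℤ)] (f : CuspForm (Gamma0 (W.conductorNorm ℤ)) 2),
        IsNewformOf W f → ∀ (ϖ : ℚ), (ϖ : ℝ) * W.realPeriodRat = plusPeriod f →
      ∃ n : ℕ, ‖PowerSeries.coeff n
        (PowerSeries.C (ϖ : ℚ_[p]) * padicLFunction f (unitRoot W p : ℚ_[p]))‖ = 1) :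
    BSDp W p :=
  bsdp_of_cha_of_unitCoeff_of_analyticRank_eq_zero W p hBCS hGr h5 hmodP hmodL hGZK hCha hX9.1
    hX9.2.2.1 hX9.2.1 hX9.2.2.2.1 hr hK hH hP hnt hpD hpN hI hq hv hcert

/-- **The typed X9 input `Typed.X9.MissingInputAt W p` DISCHARGED at such a pair** (rank 0, both
certificates). [cite: Miller2011LMS, Def. 1.1] -/
theorem missingInputAt_of_classX9_of_cha_of_unitCoeff
    (hBCS : burungale_castella_skinner_charIdeal_eq_padicLFunction)
    (hGr : greenberg_charValue_rankZero) (h5 : realPeriodRat_eq_unit_mul_plusPeriod)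
    (hmodP : nonempty_modularParametrizationData) (hmodL : hasEntireLFunction_rat)
    (hGZK : rank_eq_analyticRank_of_analyticRank_le_one)
    (hCha : Cha2005.thm52_padicValNat_shaOrder_le)
    (hX9 : ClassX9 W p) (hr : W.analyticRank = 0)
    (hK : IsImaginaryQuadratic K) (hH : SatisfiesHeegnerHypothesis N K)
    {P : (W.baseChange K).toAffine.Point} (hP : IsHeegnerPoint N W K P) (hnt : ¬ IsOfFinAddOrder P)
    (hpD : ¬ (p : ℤ) ∣ NumberField.discr K) (hpN : ¬ p ^ 2 ∣ N)
    {k : ℕ} (hI : padicValNat p (AddSubgroup.zmultiples P).index ≤ k)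
    {q : ℚ} (hq : shaAn W = (q : ℂ)) (hv : (2 * k : ℤ) ≤ padicValRat p q)
    (hcert : ∀ [NeZero (W.conductorNorm ℤ)] (f : CuspForm (Gamma0 (W.conductorNorm ℤ)) 2),
        IsNewformOf W f → ∀ (ϖ : ℚ), (ϖ : ℝ) * W.realPeriodRat = plusPeriod f →
      ∃ n : ℕ, ‖PowerSeries.coeff n
        (PowerSeries.C (ϖ : ℚ_[p]) * padicLFunction f (unitRoot W p : ℚ_[p]))‖ = 1) :
    Typed.X9.MissingInputAt W p := by
  haveI : Finite W.sha := (hGZK W (by omega)).2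
  exact Typed.X9.missingInputAt_of_bsdp W p
    (bsdp_of_classX9_of_cha_of_unitCoeff W p hBCS hGr h5 hmodP hmodL hGZK hCha hX9 hr hK hH hP hnt
      hpD hpN hI hq hv hcert)

/-- **Greenberg's `μ = 0` PROVED at such a pair**: `BSD(E,p)` (above) fed to gen 5's converse
`X9.mu_eq_zero_of_bsdp` gives `μ(X(E/ℚ_∞)) = 0` for every cyclotomic dual datum — for a residually
NON-surjective (`𝔖₄`-type or Cartan-normaliser) good ordinary prime, i.e. outside every published
`μ = 0` theorem. [cite: GreenbergLNM1716, §1 Conj. 1.11 and Thm. 4.1 (p. 102)] -/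
theorem mu_eq_zero_of_classX9_of_cha_of_unitCoeff
    (hBCS : burungale_castella_skinner_charIdeal_eq_padicLFunction)
    (hGr : greenberg_charValue_rankZero) (h5 : realPeriodRat_eq_unit_mul_plusPeriod)
    (hmodP : nonempty_modularParametrizationData) (hmodL : hasEntireLFunction_rat)
    (hGZK : rank_eq_analyticRank_of_analyticRank_le_one)
    (hCha : Cha2005.thm52_padicValNat_shaOrder_le)
    (hX9 : ClassX9 W p) (hr : W.analyticRank = 0)
    (hK : IsImaginaryQuadratic K) (hH : SatisfiesHeegnerHypothesis N K)
    {P : (W.baseChange K).toAffine.Point} (hP : IsHeegnerPoint N W K P) (hnt : ¬ IsOfFinAddOrder P)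
    (hpD : ¬ (p : ℤ) ∣ NumberField.discr K) (hpN : ¬ p ^ 2 ∣ N)
    {k : ℕ} (hI : padicValNat p (AddSubgroup.zmultiples P).index ≤ k)
    {q : ℚ} (hq : shaAn W = (q : ℂ)) (hv : (2 * k : ℤ) ≤ padicValRat p q)
    (hcert : ∀ [NeZero (W.conductorNorm ℤ)] (f : CuspForm (Gamma0 (W.conductorNorm ℤ)) 2),
        IsNewformOf W f → ∀ (ϖ : ℚ), (ϖ : ℝ) * W.realPeriodRat = plusPeriod f →
      ∃ n : ℕ, ‖PowerSeries.coeff n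
        (PowerSeries.C (ϖ : ℚ_[p]) * padicLFunction f (unitRoot W p : ℚ_[p]))‖ = 1) :
    ∀ (κ : ZpExtension ℚ p) (γ : Field.absoluteGaloisGroup ℚ),
        κ.IsCyclotomic → κ.IsTopGenerator γ → IsCyclotomicVariable p γ →
      ∀ (D : W.SelmerDualData κ γ), D.mu = 0 :=
  X9.mu_eq_zero_of_bsdp W p hBCS hGr h5 hmodP hmodL hGZK hX9 hr
    (bsdp_of_classX9_of_cha_of_unitCoeff W p hBCS hGr h5 hmodP hmodL hGZK hCha hX9 hr hK hH hP hnt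
      hpD hpN hI hq hv hcert) hcert

omit [NeZero N] [Field K] [NumberField K] in
/-- **On X9 ∧ `r = 0` the typed residue is the UPPER half only.**  Granted the published binders
and the certificate `μ(𝓛_p(E)) = 0`, any upper bound `ord_p #Ш ≤ ord_p #Ш_an`
(`Typed.MissingUpperBoundAt W p` — Cha / Jetchev–Cha index certificates, descents, …) completes
the typed input `Typed.X9.MissingInputAt W p`. [cite: Miller2011LMS, Def. 1.1] -/
theorem missingInputAt_of_missingUpperBoundAt_of_unitCoeff
    (hBCS : burungale_castella_skinner_charIdeal_eq_padicLFunction)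
    (hGr : greenberg_charValue_rankZero) (h5 : realPeriodRat_eq_unit_mul_plusPeriod)
    (hmodP : nonempty_modularParametrizationData) (hmodL : hasEntireLFunction_rat)
    (hGZK : rank_eq_analyticRank_of_analyticRank_le_one)
    (hX9 : ClassX9 W p) (hr : W.analyticRank = 0) (hup : Typed.MissingUpperBoundAt W p)
    (hcert : ∀ [NeZero (W.conductorNorm ℤ)] (f : CuspForm (Gamma0 (W.conductorNorm ℤ)) 2),
        IsNewformOf W f → ∀ (ϖ : ℚ), (ϖ : ℝ) * W.realPeriodRat = plusPeriod f →
      ∃ n : ℕ, ‖PowerSeries.coeff n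
        (PowerSeries.C (ϖ : ℚ_[p]) * padicLFunction f (unitRoot W p : ℚ_[p]))‖ = 1) :
    Typed.X9.MissingInputAt W p :=
  Typed.missingPPartAt_of_lower_of_upper W p
    (missingLowerBoundAt_of_unitCoeff_of_analyticRank_eq_zero W p hBCS hGr h5 hmodP hmodL hGZK
      hX9.2.2.1 hX9.2.1 hX9.2.2.2.1 hr hcert) hup

end Closure

end Summit.BirchSwinnertonDyer.Rank1Residual.X9
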